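/-
Copyright (c) 2026 the pub-hodgecm-mathlib formalisation cell (harness21).  Prover seat hodgecm-mathlib-K2Liu-p08 (g3): Track B «K2-LIT»,
hLiu418 = stmt-HodgeConjecture-24832; LEAD F0P6-plan (g13) RULINGS «M-157o» (S5-W1) ∕ «M-157p» (4) (S5-W1-fin merged, generic) ∕ 09:52:40Z, file S5-W1-fin-a.
-/
import Mathlib.MeasureTheory.Integral.Prod
import Mathlib.MeasureTheory.Group.Integral
import Mathlib.MeasureTheory.Integral.Bochner.Set
import Mathlib.Analysis.SpecialFunctions.Complex.Circle
import Mathlib.Topology.Algebra.Support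
import HarnessLib

/-!
# Crux `HLiu418`, road `K2_Liu`, #42S-S5 «incoherent pieces die», file S5-W1-fin-a:
# BALL-AVERAGED OSCILLATORY INTEGRALS LOCALISE ON THE ORBIT — and VANISH when the orbit misses the support

Cell `hodgecm-mathlib`, crux item hLiu418 = `stmt-HodgeConjecture-24832`; squad K2 ∕ K2Liu; prover K2Liu-p08 (g3).  THEOREMS ONLY (no `def`, no
instance, no notation, no named-fact hypothesis, no `sorry`); lane `--supports stmt-HodgeConjecture-24832 --as helper` (count-neutral helper).
PURE MEASURE THEORY, hypothesis-first: `Tsp` any locally compact ABELIAN parameter group (the unipotent radical `N_Δ(F_v) ≅ Skew_T(E_v)` of ★ Φ5, additively),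
`μT` a left-invariant measure on it, `(X, μX)` any σ-finite measure space (the Schrödinger model `𝒮(F_v^{n+n})`'s underlying space), `Φ ∈ L¹(X)`
(the Schwartz–Bruhat function, read through the implementer `Γ`), and an OSCILLATORY KERNEL `θ : X → AddChar Tsp Circle` (`θ_x(t) = ψ_v(ℓ_{x,β}(t))`,
`ℓ_{x,β}(t) = τ tr(t·(Q(x) − β))`: the `N`-word `ω(n(t))Φ = ψ(t·Q)·Φ` of the Weil representation times the Whittaker character `ψ(−τ tr(βt))`).

THE MECHANISM OF S5-W1 (RULING M-157o (i): «the `(N₁,ψ_h)`-functional on the SW image of a line at the centre is the orbital integral over `{⟨x,x⟩_v = h}`,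
`= 0` unless `a_v` represents `h`», a distributional-support statement).  In ★ Φ5 currency (`K2LiuBadPlaceWhittakerEntire.whittaker_setIntegral_ball_eq`) the
local Whittaker coefficient at the SW point IS a BALL integral `∫_{t ∈ B} f_Φ(w_Δ n(t)) ψ(−τ tr(β t)) dt`, and `f_Φ(w_Δ n(t)) = γ ∫_X ψ(t·Q(x)) (ΓΦ)(x) dx` (W-word ∘
N-word, file S5-W1-fin-b); so the coefficient is `γ ∫_{t∈B} ∫_X (ΓΦ)(x) θ_x(t) dx dt` with `θ` as above, and THIS file computes such integrals:
* §1 ORTHOGONALITY on a compact open subgroup `C`: `∫_{t∈C} χ(t) dμT = μT.real C` if the continuous additive character `χ` is trivial on `C`, and `= 0` if not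
  (`setIntegral_addChar_eq_measureReal_of_forall`, `setIntegral_addChar_eq_zero_of_exists`; additive twins of ★
  `Literature.MeasureTheory.Group.integral_char_mul_indicator_subgroup_eq_*`).
* §2 FUBINI + LOCALISATION: `∫_{t∈C} ∫_X Φ(x) θ_x(t) dμX dμT = ∫_X Φ(x) (∫_{t∈C} θ_x(t) dμT) dμX` (`setIntegral_integral_mul_addChar_swap`) and hence
  **`= μT.real C · ∫_{x : θ_x|_C ≡ 1} Φ(x) dμX`** (`setIntegral_integral_mul_addChar_eq`) — the mass of `Φ` on the «near orbit» `{x : ℓ_{x,β}(C) ⊆ ker ψ}`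
  (= `{Q(x) − β ∈ C^⊥}`: orbital-integral currency).
* §3 VANISHING: if `Φ` has compact support, `x ↦ θ_x(t)` is continuous for each `t`, the compact open subgroups `C k` increase and exhaust `Tsp`, and
  **for every `x ∈ tsupport Φ` the character `θ_x` is non-trivial** (= «`Q(x) ≠ β` on the support»: `β` is NOT represented), then for all large `k` the near
  orbit misses the support (`exists_forall_not_trivialOn_of_mem_tsupport`, a finite-subcover uniformity) and **`∫_{t∈C k} ∫_X Φ θ_x(t) = 0`**
  (`exists_forall_setIntegral_integral_mul_addChar_eq_zero`).  By Karel's ball-independence (★ Φ5) the coefficient then vanishes at its defining radius.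
HONEST LABEL.  `HC_CM` is proved only modulo the 7 printed citations (2 remaining named inputs: hLiu418 = `stmt-HodgeConjecture-24832`,
h413 = `stmt-HodgeConjecture-24833`) until rung 0 closes.

## References
* [KudlaRallis1994] S. Kudla, S. Rallis, *A regularized Siegel–Weil formula: the first term identity*, Ann. of Math. 140 (1994), §2 (the Whittaker functional of
  `ω(·)Φ(0)` is the orbital integral over `{Q(x) = β}`).
* [MoeglinVignerasWaldspurger1987] C. Mœglin, M.-F. Vignéras, J.-L. Waldspurger, LNM 1291 (1987), Chap. 2 II.6, Chap. 3 IV (twisted Jacquet modules of the Weil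
  representation are supported on the orbit).
* [HewittRoss1979] E. Hewitt, K. Ross, *Abstract Harmonic Analysis I* (1979), Thm. (23.19) (orthogonality of characters on compact groups).
* [JiangWu2016ChiB] D. Jiang, C. Wu, J. Number Theory 161 (2016), Prop. 4.1 («`W_β ∘ D_v ≠ 0` only if `β` is represented by `Y_v`»).
-/

set_option autoImplicit false
set_option linter.dupNamespace false -- the mandated namespace repeats `HodgeConjecture.HodgeConjecture`

noncomputable section

open scoped ENNReal NNReal Topology
open MeasureTheory MeasureTheory.Measure Set Filter Function

namespace Summit.HodgeConjecture.HodgeConjecture.Cruxes.HLiu418.K2LiuOscillatoryBallLocalisation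

/-! ## §1 Orthogonality of an additive character on a subgroup -/

section Orthogonality

variable {Tsp : Type*} [AddCommGroup Tsp] [MeasurableSpace Tsp] (μT : Measure Tsp)

/-- **`∫_{t∈C} χ(t) dμT = μT.real C`** when the additive character `χ` is trivial on the measurable subgroup `C`. [cite: HewittRoss1979, Thm. (23.19)] -/
theorem setIntegral_addChar_eq_measureReal_of_forall (C : AddSubgroup Tsp) (hCm : MeasurableSet (C : Set Tsp)) (χ : AddChar Tsp Circle)
    (h1 : ∀ c ∈ C, ((χ c : Circle) : ℂ) = 1) :
    ∫ t in (C : Set Tsp), ((χ t : Circle) : ℂ) ∂μT = (μT.real (C : Set Tsp) : ℂ) := by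
  rw [setIntegral_congr_fun hCm (g := fun _ => (1 : ℂ)) fun t ht => h1 t ht, setIntegral_const, Complex.real_smul, mul_one]

/-- **`∫_{t∈C} χ(t) dμT = 0`** when the additive character `χ` is NOT trivial on the subgroup `C` and `μT` is left-invariant (translate by `c₀ ∈ C` with
`χ(c₀) ≠ 1`: `c₀ + C = C`).  [cite: HewittRoss1979, Thm. (23.19)] -/
theorem setIntegral_addChar_eq_zero_of_exists [TopologicalSpace Tsp] [IsTopologicalAddGroup Tsp] [BorelSpace Tsp] [μT.IsAddLeftInvariant]
    (C : AddSubgroup Tsp) (hCm : MeasurableSet (C : Set Tsp)) (χ : AddChar Tsp Circle) {c₀ : Tsp} (hc₀ : c₀ ∈ C) (hχ : ((χ c₀ : Circle) : ℂ) ≠ 1) :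
    ∫ t in (C : Set Tsp), ((χ t : Circle) : ℂ) ∂μT = 0 := by
  rw [← integral_indicator hCm]
  have hind : ∀ t, (C : Set Tsp).indicator (fun t => ((χ t : Circle) : ℂ)) (c₀ + t) =
      ((χ c₀ : Circle) : ℂ) * (C : Set Tsp).indicator (fun t => ((χ t : Circle) : ℂ)) t := by
    intro t
    by_cases ht : t ∈ (C : Set Tsp)
    · rw [indicator_of_mem ht, indicator_of_mem (C.add_mem hc₀ ht), AddChar.map_add_eq_mul, Circle.coe_mul]
    · have h' : c₀ + t ∉ (C : Set Tsp) := fun h => ht (by simpa [add_sub_cancel_left] using C.sub_mem h hc₀)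
      rw [indicator_of_notMem ht, indicator_of_notMem h', mul_zero]
  have hshift : ∫ t, (C : Set Tsp).indicator (fun t => ((χ t : Circle) : ℂ)) (c₀ + t) ∂μT =
      ∫ t, (C : Set Tsp).indicator (fun t => ((χ t : Circle) : ℂ)) t ∂μT := integral_add_left_eq_self _ c₀
  simp_rw [hind, integral_const_mul] at hshift
  have h0 : (((χ c₀ : Circle) : ℂ) - 1) * ∫ t, (C : Set Tsp).indicator (fun t => ((χ t : Circle) : ℂ)) t ∂μT = 0 := by
    rw [sub_mul, one_mul, hshift, sub_self]
  exact (mul_eq_zero.1 h0).resolve_left (sub_ne_zero.2 hχ)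

/-- the dichotomy packaged with an indicator: `∫_{t∈C} χ = μT.real C · 𝟙[χ|_C ≡ 1]`. [cite: HewittRoss1979, Thm. (23.19)] -/
theorem setIntegral_addChar_eq_indicator [TopologicalSpace Tsp] [IsTopologicalAddGroup Tsp] [BorelSpace Tsp] [μT.IsAddLeftInvariant]
    (C : AddSubgroup Tsp) (hCm : MeasurableSet (C : Set Tsp)) (χ : AddChar Tsp Circle) :
    ∫ t in (C : Set Tsp), ((χ t : Circle) : ℂ) ∂μT =
      {χ' : AddChar Tsp Circle | ∀ c ∈ C, ((χ' c : Circle) : ℂ) = 1}.indicator (fun _ => (μT.real (C : Set Tsp) : ℂ)) χ := by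
  by_cases h : ∀ c ∈ C, ((χ c : Circle) : ℂ) = 1
  · rw [indicator_of_mem (show χ ∈ {χ' : AddChar Tsp Circle | ∀ c ∈ C, ((χ' c : Circle) : ℂ) = 1} from h)]
    exact setIntegral_addChar_eq_measureReal_of_forall μT C hCm χ h
  · rw [indicator_of_notMem (show χ ∉ {χ' : AddChar Tsp Circle | ∀ c ∈ C, ((χ' c : Circle) : ℂ) = 1} from h)]
    push Not at h
    obtain ⟨c₀, hc₀, hχ⟩ := h
    exact setIntegral_addChar_eq_zero_of_exists μT C hCm χ hc₀ hχ

end Orthogonality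

/-! ## §2 Fubini and localisation: `∫_{t∈C} ∫_X Φ(x) θ_x(t) = μT.real C · ∫_{θ_x|_C ≡ 1} Φ` -/

section Localisation

variable {Tsp : Type*} [AddCommGroup Tsp] [MeasurableSpace Tsp] (μT : Measure Tsp)
variable {X : Type*} [MeasurableSpace X] (μX : Measure X)

/-- **FUBINI for the ball-averaged oscillatory integral**: `Φ ∈ L¹(X)`, `|θ_x(t)| = 1`, `μT(C) < ∞`, and the kernel jointly measurable ⇒
`∫_{t∈C} (∫_X Φ(x) θ_x(t) dμX) dμT = ∫_X Φ(x) (∫_{t∈C} θ_x(t) dμT) dμX`.  [cite: KudlaRallis1994, §2] -/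
theorem setIntegral_integral_mul_addChar_swap [SFinite μX] [SFinite μT] {C : Set Tsp} (hCfin : μT C ≠ ∞)
    {Φ : X → ℂ} (hΦ : Integrable Φ μX) (θ : X → AddChar Tsp Circle)
    (hθm : Measurable fun p : Tsp × X => ((θ p.2 p.1 : Circle) : ℂ)) :
    ∫ t in C, (∫ x, Φ x * ((θ x t : Circle) : ℂ) ∂μX) ∂μT = ∫ x, Φ x * (∫ t in C, ((θ x t : Circle) : ℂ) ∂μT) ∂μX := by
  haveI : IsFiniteMeasure (μT.restrict C) := ⟨by rw [Measure.restrict_apply_univ]; exact hCfin.lt_top⟩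
  have hint : Integrable (uncurry fun (t : Tsp) (x : X) => Φ x * ((θ x t : Circle) : ℂ)) ((μT.restrict C).prod μX) := by
    refine Integrable.mono ((integrable_const (1 : ℂ)).mul_prod hΦ) ?_ (Eventually.of_forall fun p => ?_)
    · exact (hΦ.aestronglyMeasurable.comp_quasiMeasurePreserving (Measure.quasiMeasurePreserving_snd)).mul
        hθm.aestronglyMeasurable
    · simp only [uncurry, norm_mul, Circle.norm_coe, mul_one, one_mul, le_refl]
  rw [integral_integral_swap hint]
  refine integral_congr_ae (Eventually.of_forall fun x => ?_)
  exact integral_const_mul _ _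

/-- **LOCALISATION ON THE NEAR ORBIT**: with `μT` left-invariant, `C` a measurable subgroup of finite measure and `x ↦ θ_x(t)` continuous for each `t`,
`∫_{t∈C} (∫_X Φ(x) θ_x(t) dμX) dμT = μT.real C · ∫_{x : θ_x|_C ≡ 1} Φ(x) dμX` — the mass of `Φ` on the closed «near orbit» `{x : θ_x trivial on C}`
(`= {x : Q(x) − β ∈ C^⊥}` for `θ_x = ψ(ℓ_{x,β}(·))`).  [cite: KudlaRallis1994, §2] [cite: MoeglinVignerasWaldspurger1987, Chap. 2 II.6] -/
theorem setIntegral_integral_mul_addChar_eq [TopologicalSpace Tsp] [IsTopologicalAddGroup Tsp] [BorelSpace Tsp] [μT.IsAddLeftInvariant]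
    [SFinite μX] [SFinite μT] [TopologicalSpace X] [OpensMeasurableSpace X]
    (C : AddSubgroup Tsp) (hCm : MeasurableSet (C : Set Tsp)) (hCfin : μT (C : Set Tsp) ≠ ∞)
    {Φ : X → ℂ} (hΦ : Integrable Φ μX) (θ : X → AddChar Tsp Circle)
    (hθm : Measurable fun p : Tsp × X => ((θ p.2 p.1 : Circle) : ℂ)) (hθc : ∀ t, Continuous fun x => ((θ x t : Circle) : ℂ)) :
    ∫ t in (C : Set Tsp), (∫ x, Φ x * ((θ x t : Circle) : ℂ) ∂μX) ∂μT =
      (μT.real (C : Set Tsp) : ℂ) * ∫ x in {x | ∀ c ∈ C, ((θ x c : Circle) : ℂ) = 1}, Φ x ∂μX := by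
  have hS : MeasurableSet {x : X | ∀ c ∈ C, ((θ x c : Circle) : ℂ) = 1} := by
    have hcl : IsClosed {x : X | ∀ c ∈ C, ((θ x c : Circle) : ℂ) = 1} := by
      have he : {x : X | ∀ c ∈ C, ((θ x c : Circle) : ℂ) = 1} = ⋂ c ∈ C, {x : X | ((θ x c : Circle) : ℂ) = 1} := by
        ext x; simp only [mem_setOf_eq, mem_iInter]
      rw [he]
      exact isClosed_biInter fun c _ => isClosed_eq (hθc c) continuous_const
    exact hcl.measurableSet
  rw [setIntegral_integral_mul_addChar_swap μT μX hCfin hΦ θ hθm, ← integral_indicator hS, ← integral_const_mul]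
  refine integral_congr_ae (Eventually.of_forall fun x => ?_)
  dsimp only
  rw [setIntegral_addChar_eq_indicator μT C hCm (θ x)]
  by_cases hx : x ∈ {x : X | ∀ c ∈ C, ((θ x c : Circle) : ℂ) = 1}
  · rw [indicator_of_mem hx, indicator_of_mem (show θ x ∈ {χ' : AddChar Tsp Circle | ∀ c ∈ C, ((χ' c : Circle) : ℂ) = 1} from hx), mul_comm]
  · rw [indicator_of_notMem hx, indicator_of_notMem (show θ x ∉ {χ' : AddChar Tsp Circle | ∀ c ∈ C, ((χ' c : Circle) : ℂ) = 1} from hx), mul_zero,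
      mul_zero]

end Localisation

/-! ## §3 Vanishing: a non-trivial character at every point of the support ⇒ the ball-averaged integral dies for all large balls -/

section Vanishing

variable {Tsp : Type*} [AddCommGroup Tsp] [MeasurableSpace Tsp] (μT : Measure Tsp)
variable {X : Type*} [MeasurableSpace X] (μX : Measure X)

omit [MeasurableSpace Tsp] [MeasurableSpace X] in
/-- **UNIFORM NON-TRIVIALITY ON THE SUPPORT** (finite subcover).  `Φ` compactly supported, `x ↦ θ_x(t)` continuous for each `t`, subgroups `C k` increasing and
exhausting `Tsp`; if `θ_x` is a non-trivial character for every `x ∈ tsupport Φ` (= «`β` is not represented on the support»), then there is `k₀` such that for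
all `k ≥ k₀` and all `x ∈ tsupport Φ`, `θ_x` is already non-trivial ON `C k`.  [cite: MoeglinVignerasWaldspurger1987, Chap. 2 II.6] [cite: KudlaRallis1994, §2] -/
theorem exists_forall_exists_ne_one_of_mem_tsupport [TopologicalSpace X] {Φ : X → ℂ} (hΦs : HasCompactSupport Φ) (θ : X → AddChar Tsp Circle)
    (hθc : ∀ t, Continuous fun x => ((θ x t : Circle) : ℂ)) (Cs : ℕ → AddSubgroup Tsp) (hmono : Monotone Cs) (hexh : ∀ t, ∃ k, t ∈ Cs k)
    (hnt : ∀ x ∈ tsupport Φ, ∃ t, ((θ x t : Circle) : ℂ) ≠ 1) :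
    ∃ k₀ : ℕ, ∀ k, k₀ ≤ k → ∀ x ∈ tsupport Φ, ∃ c ∈ Cs k, ((θ x c : Circle) : ℂ) ≠ 1 := by
  classical
  choose! tt htt using hnt
  choose kk hkk using fun x => hexh (tt x)
  -- the open cover `U y = {x | θ_x (tt y) ≠ 1}` of the compact support
  obtain ⟨F, hFK, hcover⟩ := hΦs.elim_nhds_subcover (fun y => {x : X | ((θ x (tt y) : Circle) : ℂ) ≠ 1}) fun y hy =>
    (isOpen_ne_fun (hθc (tt y)) continuous_const).mem_nhds (htt y hy)
  refine ⟨F.sup kk, fun k hk x hx => ?_⟩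
  obtain ⟨y, hyF, hxy⟩ := mem_iUnion₂.1 (hcover hx)
  exact ⟨tt y, hmono (le_trans (Finset.le_sup hyF) hk) (hkk y), hxy⟩

/-- **VANISHING OF THE BALL-AVERAGED OSCILLATORY INTEGRAL.**  In the setting of `setIntegral_integral_mul_addChar_eq`, with `Φ` compactly supported, compact open
subgroups `C k` increasing and exhausting `Tsp`, `μT` finite on compacts, and `θ_x` NON-TRIVIAL for every `x ∈ tsupport Φ` (the orbit `{Q = β}` misses the
support: `β` not represented): there is `k₀` with **`∫_{t ∈ C k} (∫_X Φ(x) θ_x(t) dμX) dμT = 0` for all `k ≥ k₀`** — the local SW Whittaker value of a line dies at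
a place that does not represent the index (S5-W1 mechanism (i) of RULING M-157o; with ★ Φ5's ball-independence it dies at the defining radius too).
[cite: KudlaRallis1994, §2] [cite: MoeglinVignerasWaldspurger1987, Chap. 2 II.6] [cite: JiangWu2016ChiB, Prop. 4.1] -/
theorem exists_forall_setIntegral_integral_mul_addChar_eq_zero [TopologicalSpace Tsp] [IsTopologicalAddGroup Tsp] [BorelSpace Tsp]
    [μT.IsAddLeftInvariant] [IsFiniteMeasureOnCompacts μT] [SFinite μX] [SFinite μT] [TopologicalSpace X] [OpensMeasurableSpace X]
    {Φ : X → ℂ} (hΦ : Integrable Φ μX) (hΦs : HasCompactSupport Φ) (θ : X → AddChar Tsp Circle)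
    (hθm : Measurable fun p : Tsp × X => ((θ p.2 p.1 : Circle) : ℂ)) (hθc : ∀ t, Continuous fun x => ((θ x t : Circle) : ℂ))
    (Cs : ℕ → AddSubgroup Tsp) (hCo : ∀ k, IsOpen (Cs k : Set Tsp)) (hCc : ∀ k, IsCompact (Cs k : Set Tsp)) (hmono : Monotone Cs)
    (hexh : ∀ t, ∃ k, t ∈ Cs k) (hnt : ∀ x ∈ tsupport Φ, ∃ t, ((θ x t : Circle) : ℂ) ≠ 1) :
    ∃ k₀ : ℕ, ∀ k, k₀ ≤ k → ∫ t in (Cs k : Set Tsp), (∫ x, Φ x * ((θ x t : Circle) : ℂ) ∂μX) ∂μT = 0 := by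
  obtain ⟨k₀, hk₀⟩ := exists_forall_exists_ne_one_of_mem_tsupport hΦs θ hθc Cs hmono hexh hnt
  refine ⟨k₀, fun k hk => ?_⟩
  rw [setIntegral_integral_mul_addChar_eq μT μX (Cs k) (hCo k).measurableSet (hCc k).measure_ne_top hΦ θ hθm hθc,
    setIntegral_eq_zero_of_forall_eq_zero fun x hx => ?_, mul_zero]
  -- on the near orbit of `C k` the function `Φ` vanishes: such an `x` is off the support
  refine image_eq_zero_of_notMem_tsupport fun hxs => ?_
  obtain ⟨c, hc, hne⟩ := hk₀ k hk x hxs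
  exact hne (hx c hc)

end Vanishing


end Summit.HodgeConjecture.HodgeConjecture.Cruxes.HLiu418.K2LiuOscillatoryBallLocalisation

end
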